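import Summits.Ventures.CertifiedManyBodySolver.Theorems.TcThermcert1SeamStationarity
import Literature.MathematicalPhysics.QuantumLattice.HubbardNNNHoppingFlux
import Literature.MathematicalPhysics.QuantumLattice.HubbardTorusFlux
import Literature.MathematicalPhysics.QuantumLattice.AbelianFieldTensor
import Mathlib
import HarnessLib

/-!
# Time reversal and seam bookkeeping for the quantum-belief-propagation port (stub B of line `gauge_qbp_far_seam`)

Helper module for route `TcThermcert1`, cruxes K1′ `ThermalStiffnessCeilingU8b8_le_7o44` (item `stmt-Ventures-24560`) and
K1 `ThermalStiffnessCeilingU8b10_le_1o8` (item `stmt-Ventures-26381`), line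
`Cruxes/ThermalStiffnessCeilingU8b10_le_1o8/Lines/gauge_qbp_far_seam.lean` v1.2, registered stub B
(`stub_farCutCurrent_of_clustering`: the fermionic, sector-compressed port of Capel–Moscolari–Teufel–Wessel, arXiv:2310.09182,
Thm 14, applied to the perturbation `V_φ = seamTwist L φ` and the far-cut bond currents). Two finite-dimensional folklore inputs
of that port, stated over the tree's literal operators so that the line file can `rw` with them:

* §1 TIME REVERSAL (the `φ = 0` baseline). The flux-free torus Hamiltonian `hubbardTorusTT'Flux L 0 U 0` is entrywise real
  (`hubbardTorusFlux_map_conj` at `θ = 0`) and the plain bond current `Σ_σ(−i c†_{(X,y)σ} c_{(X−1,y)σ} + i c†_{(X−1,y)σ} c_{(X,y)σ})`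
  is entrywise imaginary (`farBond_map_conj`), so its compressed Gibbs expectation in EVERY coordinate sector has zero real
  part (`re_gibbsState_fluxZeroBlock_farBond_eq_zero`, via the landed `re_gibbsState_eq_zero_of_map_starRingEnd`), and so does
  the sum over the `L` bonds of a cut (`sum_re_gibbsState_fluxZeroBlock_farBond_eq_zero`). In the line this reads
  `farCutCurrent L U n β 0 = 0`: the persistent current is a pure RESPONSE to the seam perturbation.
* §2 SEAM BOOKKEEPING. The perturbation switched on by the flux is exactly the seam operator,
  `hubbardTorusTT'Flux L 0 U θ − hubbardTorusTT'Flux L 0 U 0 = seamTwist L θ` (`hubbardTorusTT'Flux_zero_sub_eq_seamTwist`), and each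
  of its `4L` Peierls coefficients has modulus `|1 − e^{±iθ}| = 2|sin(θ/2)| ≤ |θ|` (`norm_one_sub_cexp_seamCoeff`,
  `norm_one_sub_cexp_seamCoeff_le_abs`) — the flux-proportional size that enters the QBP factor `e^{O(β‖V_φ‖)}`.
  (The operator-norm form `‖seamTwist L θ‖ ≤ 8L|sin(θ/2)|` is left to the port itself, where the `ℓ²`-operator-norm instance is
  pinned together with the generic CAR-algebra lemmas; cf. the design note of `HubbardLSMFillingAssembly`.)
Theorems only; nothing about superconductivity in the Hubbard model is proved by anything in this file.
-/

noncomputable section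

open scoped ComplexOrder ComplexConjugate
open Matrix Finset
open Literature.MathematicalPhysics.QuantumLattice

namespace Summit.Ventures.CertifiedManyBodySolver.Theorems.TcThermcert1.GaugeQbpFarSeam

/-! ## §1 Time reversal: the flux-free expectation of a bond current has zero real part -/

section TimeReversal

variable {m α β : Type*}

/-- Compression to a block commutes with an entrywise map. [folklore] -/
theorem toBlock_map (M : Matrix m m α) (f : α → β) (p q : m → Prop) :
    (M.toBlock p q).map f = (M.map f).toBlock p q := rfl

/-- Compression to a block commutes with negation. [folklore] -/
theorem neg_toBlock [Neg α] (M : Matrix m m α) (p q : m → Prop) :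
    (-M).toBlock p q = -(M.toBlock p q) := rfl

open Literature.Probability.LatticeModels

variable (L : ℕ) [NeZero L]

/-- The plain two-spin bond current through the bond `(X−1,y)–(X,y)` is entrywise imaginary in the occupation basis:
complex conjugation negates it (`c†`, `c` are real matrices). [folklore] -/
theorem farBond_map_conj (X y : ZMod L) :
    (∑ σ : Fin 2,
        ((-Complex.I) • (creation (orb (FermionTorus.ofTorusSite (![X, y] : TorusSite 2 L)) σ) *
            annihilation (orb (FermionTorus.ofTorusSite (![X - 1, y] : TorusSite 2 L)) σ)) +
          Complex.I • (creation (orb (FermionTorus.ofTorusSite (![X - 1, y] : TorusSite 2 L)) σ) *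
            annihilation (orb (FermionTorus.ofTorusSite (![X, y] : TorusSite 2 L)) σ)))).map (starRingEnd ℂ) =
      -(∑ σ : Fin 2,
        ((-Complex.I) • (creation (orb (FermionTorus.ofTorusSite (![X, y] : TorusSite 2 L)) σ) *
            annihilation (orb (FermionTorus.ofTorusSite (![X - 1, y] : TorusSite 2 L)) σ)) +
          Complex.I • (creation (orb (FermionTorus.ofTorusSite (![X - 1, y] : TorusSite 2 L)) σ) *
            annihilation (orb (FermionTorus.ofTorusSite (![X, y] : TorusSite 2 L)) σ)))) := by
  rw [map_conj_sum, ← Finset.sum_neg_distrib]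
  refine Finset.sum_congr rfl fun σ _ => ?_
  rw [Matrix.map_add _ (map_add _), map_conj_smul, map_conj_smul, Matrix.map_mul, Matrix.map_mul,
    creation_map_conj, annihilation_map_conj, creation_map_conj, annihilation_map_conj, map_neg, Complex.conj_I,
    neg_neg, neg_add, ← neg_smul, ← neg_smul, neg_neg]

/-- **Time reversal (the `φ = 0` baseline of the far-cut current).** In the compressed Gibbs state of ANY coordinate sector
`p` of the flux-FREE torus `hubbardTorusTT'Flux L 0 U 0` (an entrywise real matrix) the expectation of the plain bond current
through `(X−1,y)–(X,y)` (an entrywise imaginary matrix) has zero real part. [folklore] -/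
theorem re_gibbsState_fluxZeroBlock_farBond_eq_zero (U β : ℝ) (X y : ZMod L)
    (p : Finset (Orb (FermionTorus 2 L)) → Prop) [DecidablePred p] :
    Complex.re (gibbsState β ((hubbardTorusTT'Flux L 0 U 0).toBlock p p)
        ((∑ σ : Fin 2,
            ((-Complex.I) • (creation (orb (FermionTorus.ofTorusSite (![X, y] : TorusSite 2 L)) σ) *
                annihilation (orb (FermionTorus.ofTorusSite (![X - 1, y] : TorusSite 2 L)) σ)) +
              Complex.I • (creation (orb (FermionTorus.ofTorusSite (![X - 1, y] : TorusSite 2 L)) σ) *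
                annihilation (orb (FermionTorus.ofTorusSite (![X, y] : TorusSite 2 L)) σ)))).toBlock p p)) = 0 := by
  apply re_gibbsState_eq_zero_of_map_starRingEnd
  · rw [toBlock_map, hubbardTorusTT'Flux_tPrime_zero, hubbardTorusFlux_map_conj, neg_zero]
  · rw [toBlock_map, farBond_map_conj, neg_toBlock]

/-- Summed form: the flux-free far-cut current vanishes in every coordinate sector (the line's `farCutCurrent L U n β 0 = 0`).
[folklore] -/
theorem sum_re_gibbsState_fluxZeroBlock_farBond_eq_zero (U β : ℝ) (X : ZMod L)
    (p : Finset (Orb (FermionTorus 2 L)) → Prop) [DecidablePred p] :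
    ∑ y : ZMod L, Complex.re (gibbsState β ((hubbardTorusTT'Flux L 0 U 0).toBlock p p)
        ((∑ σ : Fin 2,
            ((-Complex.I) • (creation (orb (FermionTorus.ofTorusSite (![X, y] : TorusSite 2 L)) σ) *
                annihilation (orb (FermionTorus.ofTorusSite (![X - 1, y] : TorusSite 2 L)) σ)) +
              Complex.I • (creation (orb (FermionTorus.ofTorusSite (![X - 1, y] : TorusSite 2 L)) σ) *
                annihilation (orb (FermionTorus.ofTorusSite (![X, y] : TorusSite 2 L)) σ)))).toBlock p p)) = 0 :=
  Finset.sum_eq_zero fun y _ => re_gibbsState_fluxZeroBlock_farBond_eq_zero L U β X y p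

end TimeReversal

/-! ## §2 Seam bookkeeping: the perturbation is the seam operator, with flux-proportional coefficients -/

section Seam

open Literature.Probability.LatticeModels

variable (L : ℕ) [NeZero L]

/-- The Peierls coefficients of the seam: `|1 − e^{±iθ}| = 2|sin(θ/2)|`. [folklore] -/
theorem norm_one_sub_cexp_seamCoeff (θ : ℝ) (b : Bool) :
    ‖(1 : ℂ) - Complex.exp ((if b then 1 else -1) * Complex.I * θ)‖ = 2 * |Real.sin (θ / 2)| := by
  cases b
  · simp only [Bool.false_eq_true, ↓reduceIte]
    have h : (-1 * Complex.I * (θ : ℂ)) = ((-θ : ℝ) : ℂ) * Complex.I := by push_cast; ring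
    rw [h, norm_one_sub_cexp_mul_I, neg_div, Real.sin_neg, abs_neg]
  · simp only [↓reduceIte]
    have h : (1 * Complex.I * (θ : ℂ)) = (θ : ℂ) * Complex.I := by ring
    rw [h, norm_one_sub_cexp_mul_I]

/-- The Peierls coefficients are flux-proportional: `|1 − e^{±iθ}| ≤ |θ|`. [folklore] -/
theorem norm_one_sub_cexp_seamCoeff_le_abs (θ : ℝ) (b : Bool) :
    ‖(1 : ℂ) - Complex.exp ((if b then 1 else -1) * Complex.I * θ)‖ ≤ |θ| := by
  rw [norm_one_sub_cexp_seamCoeff]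
  have hs : |Real.sin (θ / 2)| ≤ |θ / 2| := Real.abs_sin_le_abs
  rw [abs_div, abs_two] at hs
  linarith

/-- The perturbation switched on by the flux is the seam operator:
`hubbardTorusTT'Flux L 0 U θ − hubbardTorusTT'Flux L 0 U 0 = seamTwist L θ` (`t′ = 0`; `seamTwist L 0 = 0`). [folklore] -/
theorem hubbardTorusTT'Flux_zero_sub_eq_seamTwist (U θ : ℝ) :
    hubbardTorusTT'Flux L 0 U θ - hubbardTorusTT'Flux L 0 U 0 = seamTwist L θ := by
  rw [hubbardTorusTT'Flux_tPrime_zero, hubbardTorusTT'Flux_tPrime_zero, hubbardTorusFlux_eq, hubbardTorusFlux_eq,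
    seamTwist_zero, add_zero, add_sub_cancel_left]

/-- Equivalently `hubbardTorusTT'Flux L 0 U θ = hubbardTorusTT'Flux L 0 U 0 + seamTwist L θ` — the `H + V` splitting the
quantum-belief-propagation port is applied to. [folklore] -/
theorem hubbardTorusTT'Flux_zero_eq_add_seamTwist (U θ : ℝ) :
    hubbardTorusTT'Flux L 0 U θ = hubbardTorusTT'Flux L 0 U 0 + seamTwist L θ := by
  rw [← hubbardTorusTT'Flux_zero_sub_eq_seamTwist L U θ, add_sub_cancel]

end Seam

end Summit.Ventures.CertifiedManyBodySolver.Theorems.TcThermcert1.GaugeQbpFarSeam
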